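import Literature.Topology.FourManifolds.Spin
import Literature.Topology.FourManifolds.SmoothOrientation
import Literature.Topology.FourManifolds.TwoKnotNormalSection
import Mathlib.Geometry.Manifold.ContMDiffMFDeriv
import Mathlib.LinearAlgebra.Alternating.Curry
import HarnessLib

/-!
# An oriented manifold immersed in codimension one in Euclidean space is stably parallelizable

Topic `Literature/Topology/FourManifolds` (infrastructure; fact seat
`provefact-Literature.Topology.FourManifolds.eliash-c5add00ae1`, used by
`HomotopyS4FoldMapStable.lean`).  **Everything in this file is proved; no definition of a notion,
no named fact.**

M. Kervaire, J. Milnor, *Groups of homotopy spheres I*, Ann. of Math. 77 (1963), §3, p. 508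
(proof of Thm. 3.1: "`τ ⊕ ν` is trivial … hence `τ` is stably trivial iff `ν` is"), with
J. Milnor, J. Stasheff, *Characteristic classes* (1974), §2 (Whitney sum `τ ⊕ ν ≅ εⁿ⁺ᵏ` of an
immersion into `ℝⁿ⁺ᵏ`) and M. Hirsch, *Differential Topology* (1976), Ch. 4 §4 (the normal line
bundle of a two-sided — e.g. oriented — immersed hypersurface is trivial): **if an oriented
`n`-manifold `M` admits a `C¹` immersion `F : M → ℝⁿ⁺¹`, then `TM ⊕ ℝ` is trivial**
(`IsStablyParallelizable`, `Spin.lean`).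

Proof formalised here (no bundle theory beyond the tree's framings):
* §1 the `n`-fold cross product transforms under a linear change of the `n` arguments by the
  determinant (`vecCross_comp_eq_det_smul`; the tree's `vecCross`, `TwoKnotNormalSection.lean`);
* §2 the **oriented unit normal** `ξ x = ±‖c x‖⁻¹ c x`, `c x = vecCross (dF_x e₀, …, dF_x e_{n-1})`
  read in the preferred chart at `x`, the sign being `+` iff the orientation `o x`
  (`SmoothOrientation`, read in the same chart) is the standard one; the chart-change rule of §1
  and the defining property of a smooth orientation (`o y = o x₀ ↔ det (chart change) > 0`) make
  `ξ` continuous (`continuous_orientedNormal`), and `ξ x ∉ im dF_x`;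
* §3 the framing `x ↦ (dF_x ⊕ ξ x)⁻¹ eⱼ` of `TM ⊕ ℝ` (`isStablyParallelizable_of_immersion_succ`),
  continuity being checked in the trivialisation of `TM` at each point as in
  `isStablyParallelizable_of_transverse_framing` (`LevelStablyParallelizable.lean`).

## References

* M. Kervaire, J. Milnor, *Groups of homotopy spheres I*, Ann. of Math. 77 (1963), §3 p. 508.
  [KervaireMilnorAnnals1963]
* J. Milnor, J. Stasheff, *Characteristic classes*, Ann. of Math. Studies 76 (1974), §2, §12.
  [MilnorStasheff1974]
* M. W. Hirsch, *Differential Topology*, GTM 33 (1976), Ch. 4 §2, §4. [HirschDT1976]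
-/

open scoped Manifold ContDiff Topology RealInnerProductSpace
open Set Function Bundle Filter Module

noncomputable section

namespace Literature.Topology.FourManifolds

/-- Local notation: `𝔼 n` is the model Euclidean space `EuclideanSpace ℝ (Fin n)`. -/
local notation "𝔼 " n:arg => EuclideanSpace ℝ (Fin n)

/-! ### §1 The cross product under a linear change of the arguments -/

section CrossDet

variable {n : ℕ}

/-- The pairing `u ↦ ⟪vecCross (L u₀, …, L u_{n-1}), w⟫` as an alternating `n`-form on `ℝⁿ`: the
determinant of the rows `(w, L u₀, …, L u_{n-1})` (`inner_vecCross`), i.e. Mathlib's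
`Matrix.detRowAlternating` with the first row frozen (`AlternatingMap.curryLeft`) composed with
the linear map `L`. [folklore] -/
def vecCrossPairing (L : 𝔼 n →L[ℝ] 𝔼 (n+1)) (w : 𝔼 (n+1)) : (𝔼 n) [⋀^Fin n]→ₗ[ℝ] ℝ :=
  (AlternatingMap.curryLeft (Matrix.detRowAlternating : (Fin (n+1) → ℝ) [⋀^Fin (n+1)]→ₗ[ℝ] ℝ)
      (⇑w)).compLinearMap
    ((WithLp.linearEquiv 2 ℝ (Fin (n+1) → ℝ)).toLinearMap ∘ₗ (L : 𝔼 n →ₗ[ℝ] 𝔼 (n+1)))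

/-- The alternating form `vecCrossPairing L w` is the pairing `⟪vecCross (L ∘ u), w⟫`. [folklore] -/
theorem vecCrossPairing_apply (L : 𝔼 n →L[ℝ] 𝔼 (n+1)) (w : 𝔼 (n+1)) (u : Fin n → 𝔼 n) :
    vecCrossPairing L w u = ⟪vecCross (fun i => L (u i)), w⟫ := by
  rw [inner_vecCross, vecCrossPairing, AlternatingMap.compLinearMap_apply,
    AlternatingMap.curryLeft_apply_apply]
  rfl

/-- **The cross product transforms by the determinant**: for linear `L : ℝⁿ → ℝⁿ⁺¹` and
`T : ℝⁿ → ℝⁿ`, `vecCross (L (T e₀), …, L (T e_{n-1})) = det T • vecCross (L e₀, …, L e_{n-1})`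
(the pairing with any `w` is an alternating `n`-form in the arguments, hence a multiple of the
determinant: `AlternatingMap.eq_smul_basis_det`, `Basis.det_comp`). [folklore] -/
theorem vecCross_comp_eq_det_smul (L : 𝔼 n →L[ℝ] 𝔼 (n+1)) (T : 𝔼 n →L[ℝ] 𝔼 n) :
    vecCross (fun i => L (T (EuclideanSpace.single i (1 : ℝ)))) =
      LinearMap.det (T : 𝔼 n →ₗ[ℝ] 𝔼 n) • vecCross (fun i => L (EuclideanSpace.single i (1 : ℝ))) := by
  refine ext_inner_right ℝ fun w => ?_
  set b : Basis (Fin n) ℝ (𝔼 n) := (EuclideanSpace.basisFun (Fin n) ℝ).toBasis with hb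
  have hbi : ∀ i, b i = EuclideanSpace.single i (1 : ℝ) := fun i => by
    simp [hb]
  have key := (vecCrossPairing L w).eq_smul_basis_det b
  have h1 : vecCrossPairing L w (fun i => T (b i)) =
      vecCrossPairing L w b * b.det (fun i => T (b i)) := by
    conv_lhs => rw [key]
    rfl
  have h2 : b.det (fun i => T (b i)) = LinearMap.det (T : 𝔼 n →ₗ[ℝ] 𝔼 n) := by
    have := b.det_comp (T : 𝔼 n →ₗ[ℝ] 𝔼 n) b
    rw [b.det_self, mul_one] at this
    exact this
  rw [inner_smul_left, ← vecCrossPairing_apply, ← vecCrossPairing_apply]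
  simp only [← hbi]
  rw [h1, h2, mul_comm]
  simp

end CrossDet

/-! ### §2 The oriented unit normal of a codimension-one immersion -/

section Normal

variable {n : ℕ} {M : Type*} [TopologicalSpace M] [ChartedSpace (𝔼 n) M] [IsManifold (𝓡 n) 1 M]

/-- The standard orientation of the model space `ℝⁿ`, indexed by `Fin (finrank ℝ ℝⁿ)` as in
`SmoothOrientation` (the orientation of the standard basis, reindexed). [folklore] -/
def stdOrientationModel (n : ℕ) : Orientation ℝ (𝔼 n) (Fin (finrank ℝ (𝔼 n))) :=
  ((EuclideanSpace.basisFun (Fin n) ℝ).toBasis.reindex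
    (finCongr (finrank_euclideanSpace_fin (𝕜 := ℝ) (n := n)).symm)).orientation

/-- The sign `±1` of a smooth orientation at `x` relative to the standard orientation of the
model space (both read in the preferred chart at `x`). [folklore] -/
def orientationSignStd (o : SmoothOrientation (𝓡 n) M) (x : M) : ℝ :=
  haveI := Classical.dec (o x = stdOrientationModel n)
  if o x = stdOrientationModel n then 1 else -1

/-- The orientation sign is `±1`, in particular non-zero. [folklore] -/
theorem orientationSign_ne_zero (o : SmoothOrientation (𝓡 n) M) (x : M) :
    orientationSignStd o x ≠ 0 := by
  unfold orientationSignStd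
  split_ifs <;> norm_num

/-- **Sign rule.** Near `x₀`, if the Jacobian determinant `d` of the chart change `y → x₀` at `y`
is non-zero, then `orientationSignStd o y * d = orientationSignStd o x₀ * |d|` (same orientation iff
`d > 0`, `SmoothOrientation.eventually_eq_iff`; there are exactly two orientations,
`Orientation.eq_or_eq_neg`). [folklore] -/
theorem orientationSign_mul_det_eventually (o : SmoothOrientation (𝓡 n) M) (x₀ : M) :
    ∀ᶠ y in 𝓝 x₀, ∀ d : ℝ, d = LinearMap.det ((tangentCoordChange (𝓡 n) y x₀ y :
        𝔼 n →L[ℝ] 𝔼 n) : 𝔼 n →ₗ[ℝ] 𝔼 n) → d ≠ 0 →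
      orientationSignStd o y * d = orientationSignStd o x₀ * |d| := by
  filter_upwards [o.eventually_eq_iff x₀] with y hy d hd hd0
  rw [← hd] at hy
  have hcard : Fintype.card (Fin (finrank ℝ (𝔼 n))) = finrank ℝ (𝔼 n) := Fintype.card_fin _
  rcases lt_or_gt_of_ne hd0 with hneg | hpos
  · -- negative Jacobian: the orientations differ, so the signs are opposite
    have hne : o y ≠ o x₀ := fun h => absurd (hy.1 h) (not_lt.2 hneg.le)
    rw [abs_of_neg hneg]
    unfold orientationSignStd
    by_cases h1 : o y = stdOrientationModel n
    · have h2 : o x₀ ≠ stdOrientationModel n := fun h2 => hne (h1.trans h2.symm)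
      rw [if_pos h1, if_neg h2]
      ring
    · have h3 : o y = -stdOrientationModel n :=
        (Orientation.eq_or_eq_neg (o y) (stdOrientationModel n) hcard).resolve_left h1
      have h2 : o x₀ = stdOrientationModel n := by
        rcases Orientation.eq_or_eq_neg (o x₀) (stdOrientationModel n) hcard with h | h
        · exact h
        · exact absurd (h3.trans h.symm) hne
      rw [if_neg h1, if_pos h2]
      ring
  · -- positive Jacobian: same orientation, same sign
    have heq : o y = o x₀ := hy.2 hpos
    rw [abs_of_pos hpos]
    unfold orientationSignStd
    rw [heq]

/-- The differential `dF_x : T_x M → T_{F x} ℝⁿ⁺¹` of a map into the model space, as a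
continuous linear map `ℝⁿ →L ℝⁿ⁺¹` (the tangent spaces ARE the model spaces; this abbreviation
only fixes the syntactic type). [folklore] -/
abbrev mfderivE (F : M → 𝔼 (n+1)) (x : M) : 𝔼 n →L[ℝ] 𝔼 (n+1) := mfderiv (𝓡 n) (𝓡 (n+1)) F x

variable {F : M → 𝔼 (n+1)}

/-- The cross product of the columns of `dF_x` read in the preferred chart at `x`:
`c x = vecCross (dF_x e₀, …, dF_x e_{n-1})`, a normal vector to `im dF_x`. [folklore] -/
def crossNormal (F : M → 𝔼 (n+1)) (x : M) : 𝔼 (n+1) :=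
  vecCross fun i => mfderivE F x (EuclideanSpace.single i (1 : ℝ))

/-- The **oriented unit normal** of an immersion `F : M → ℝⁿ⁺¹` of an oriented `n`-manifold:
`ξ x = orientationSignStd o x • ‖c x‖⁻¹ • c x` (Hirsch 1976, Ch. 4 §4: the normal field of a
two-sided hypersurface). [folklore] -/
def orientedNormal (o : SmoothOrientation (𝓡 n) M) (F : M → 𝔼 (n+1)) (x : M) : 𝔼 (n+1) :=
  (orientationSignStd o x * ‖crossNormal F x‖⁻¹) • crossNormal F x

omit [IsManifold (𝓡 n) 1 M] in
/-- The cross normal is orthogonal to the image of the differential. [folklore] -/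
theorem inner_crossNormal_mfderiv (F : M → 𝔼 (n+1)) (x : M) (u : 𝔼 n) :
    ⟪crossNormal F x, mfderivE F x u⟫ = 0 := by
  have hu : u = ∑ i, u i • EuclideanSpace.single i (1 : ℝ) := by
    simpa using ((EuclideanSpace.basisFun (Fin n) ℝ).sum_repr u).symm
  conv_lhs => rw [hu]
  rw [map_sum, inner_sum]
  refine Finset.sum_eq_zero fun i _ => ?_
  rw [map_smul, inner_smul_right, crossNormal, inner_vecCross_self, mul_zero]

/-- The standard basis vectors `eᵢ = single i 1` of `ℝᵏ` are linearly independent. [folklore] -/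
theorem linearIndependent_euclideanSingle_one (k : ℕ) :
    LinearIndependent ℝ fun i : Fin k => (EuclideanSpace.single i (1 : ℝ) : 𝔼 k) := by
  have h := (EuclideanSpace.basisFun (Fin k) ℝ).toBasis.linearIndependent
  have heq : (⇑(EuclideanSpace.basisFun (Fin k) ℝ).toBasis : Fin k → 𝔼 k) =
      fun i => EuclideanSpace.single i (1 : ℝ) := by
    funext i
    simp
  rwa [heq] at h

omit [IsManifold (𝓡 n) 1 M] in
/-- For an immersion the cross normal is non-zero (the columns of `dF_x` are linearly
independent). [folklore] -/
theorem crossNormal_ne_zero {x : M} (hinj : Injective (mfderivE F x)) :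
    crossNormal F x ≠ 0 := by
  refine vecCross_ne_zero_of_linearIndependent ?_
  exact (linearIndependent_euclideanSingle_one n).map' ((mfderivE F x : 𝔼 n →L[ℝ] 𝔼 (n+1)) :
    𝔼 n →ₗ[ℝ] 𝔼 (n+1)) (LinearMap.ker_eq_bot.2 hinj)

/-- The oriented normal is orthogonal to the image of the differential. [folklore] -/
theorem inner_orientedNormal_mfderiv (o : SmoothOrientation (𝓡 n) M) (F : M → 𝔼 (n+1)) (x : M)
    (u : 𝔼 n) : ⟪orientedNormal o F x, mfderivE F x u⟫ = 0 := by
  rw [orientedNormal, inner_smul_left, inner_crossNormal_mfderiv, mul_zero]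

/-- For an immersion the oriented normal is non-zero. [folklore] -/
theorem orientedNormal_ne_zero (o : SmoothOrientation (𝓡 n) M) {x : M}
    (hinj : Injective (mfderivE F x)) : orientedNormal o F x ≠ 0 := by
  have h := crossNormal_ne_zero hinj
  have h' : ‖crossNormal F x‖⁻¹ ≠ 0 := inv_ne_zero (norm_ne_zero_iff.2 h)
  rw [orientedNormal]
  exact smul_ne_zero (mul_ne_zero (orientationSign_ne_zero o x) h') h

/-- **Transversality**: for an immersion, `dF_x u + r • ξ x = 0` forces `u = 0` and `r = 0`.
[folklore] -/
theorem eq_zero_of_mfderiv_add_smul_orientedNormal (o : SmoothOrientation (𝓡 n) M) {x : M}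
    (hinj : Injective (mfderivE F x)) {u : 𝔼 n} {r : ℝ}
    (h : mfderivE F x u + r • orientedNormal o F x = 0) : u = 0 ∧ r = 0 := by
  have h1 := congrArg (fun v => ⟪orientedNormal o F x, v⟫) h
  simp only [inner_add_right, inner_orientedNormal_mfderiv, inner_smul_right, inner_zero_right,
    zero_add, real_inner_self_eq_norm_sq] at h1
  have hn : ‖orientedNormal o F x‖ ^ 2 ≠ 0 :=
    pow_ne_zero 2 (norm_ne_zero_iff.2 (orientedNormal_ne_zero o hinj))
  have hr : r = 0 := by
    rcases mul_eq_zero.1 h1 with hr | hn'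
    · exact hr
    · exact absurd hn' hn
  subst hr
  rw [zero_smul, add_zero] at h
  exact ⟨hinj (h.trans (map_zero _).symm), rfl⟩

/-- **Continuity of the oriented normal** (Hirsch 1976, Ch. 4 §4).  At `x₀`, write
`dF_y = A y ∘ T_y` with `A y` the differential in the tangent coordinates of the chart at `x₀`
(continuous in `y`, `ContMDiffAt.mfderiv_const`) and `T_y` the chart change `y → x₀`; by §1,
`c y = det T_y • c̃ y` with `c̃ y = vecCross (A y e₀, …)`, and by the sign rule
`orientationSignStd o y · det T_y = orientationSignStd o x₀ · |det T_y|`; so near `x₀` the oriented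
normal is `orientationSignStd o x₀ • ‖c̃ y‖⁻¹ • c̃ y` with `c̃` continuous and non-vanishing.
[cite: HirschDT1976, Ch. 4 §4] -/
theorem continuous_orientedNormal (o : SmoothOrientation (𝓡 n) M)
    (hF : ContMDiff (𝓡 n) (𝓡 (n+1)) 1 F) (hinj : ∀ x, Injective (mfderivE F x)) :
    Continuous (orientedNormal o F) := by
  rw [continuous_iff_continuousAt]
  intro x₀
  -- the differential in the tangent coordinates of the chart at `x₀`
  set A : M → 𝔼 n →L[ℝ] 𝔼 (n+1) :=
    inTangentCoordinates (𝓡 n) (𝓡 (n+1)) id F (mfderiv (𝓡 n) (𝓡 (n+1)) F) x₀ with hA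
  have hAc : ContinuousAt A x₀ :=
    ((hF x₀).mfderiv_const (m := 0) (by rw [zero_add])).continuousAt
  -- chart change `T_y : y → x₀`
  set T : M → 𝔼 n →L[ℝ] 𝔼 n := fun y => tangentCoordChange (𝓡 n) y x₀ y with hT
  have hmem : ∀ᶠ y in 𝓝 x₀, y ∈ (chartAt (𝔼 n) x₀).source :=
    (chartAt (𝔼 n) x₀).open_source.mem_nhds (mem_chart_source (𝔼 n) x₀)
  -- `dF_y = A y ∘ T_y`
  have hAT : ∀ᶠ y in 𝓝 x₀, ∀ u, mfderivE F y u = A y (T y u) := by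
    filter_upwards [hmem] with y hy u
    have hy' : y ∈ (extChartAt (𝓡 n) y).source ∩ (extChartAt (𝓡 n) x₀).source ∩
        (extChartAt (𝓡 n) y).source := by
      simp only [extChartAt_source, mem_inter_iff, mem_chart_source, hy, and_self]
    rw [hA, inTangentCoordinates_eq _ _ _ (show id y ∈ (chartAt (𝔼 n) (id x₀)).source from hy)
      (by simp)]
    change _ = (tangentBundleCore (𝓡 (n+1)) (𝔼 (n+1))).coordChange (achart (𝔼 (n+1)) (F y))
      (achart (𝔼 (n+1)) (F x₀)) (F y) (mfderivE F y
        (tangentCoordChange (𝓡 n) x₀ y y (tangentCoordChange (𝓡 n) y x₀ y u)))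
    rw [tangentBundleCore_coordChange_model_space, tangentCoordChange_comp hy',
      tangentCoordChange_self (by simp)]
    rfl
  -- the cross normal read at `x₀`
  set c' : M → 𝔼 (n+1) := fun y => vecCross fun i => A y (EuclideanSpace.single i (1 : ℝ)) with hc'
  have hcc' : ∀ᶠ y in 𝓝 x₀, crossNormal F y =
      LinearMap.det ((T y : 𝔼 n →L[ℝ] 𝔼 n) : 𝔼 n →ₗ[ℝ] 𝔼 n) • c' y := by
    filter_upwards [hAT] with y hy
    rw [crossNormal, hc']
    simp only [hy]
    exact vecCross_comp_eq_det_smul (A y) (T y)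
  -- continuity of `c'`
  have hc'c : ContinuousAt c' x₀ := by
    have h1 : ContinuousAt (fun y => fun i : Fin n => A y (EuclideanSpace.single i (1 : ℝ))) x₀ :=
      continuousAt_pi.2 fun i => hAc.clm_apply continuousAt_const
    exact contDiff_vecCross.continuous.continuousAt.comp h1
  -- near `x₀` the determinant does not vanish and `c'` does not vanish
  have hne : ∀ᶠ y in 𝓝 x₀, LinearMap.det ((T y : 𝔼 n →L[ℝ] 𝔼 n) : 𝔼 n →ₗ[ℝ] 𝔼 n) ≠ 0 ∧
      c' y ≠ 0 := by
    filter_upwards [hcc'] with y hy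
    have h := crossNormal_ne_zero (hinj y)
    rw [hy] at h
    exact ⟨fun h0 => h (by rw [h0, zero_smul]), fun h0 => h (by rw [h0, smul_zero])⟩
  have hc'0 : c' x₀ ≠ 0 := (hne.self_of_nhds).2
  -- the local formula for the oriented normal
  have hloc : ∀ᶠ y in 𝓝 x₀, orientedNormal o F y =
      (orientationSignStd o x₀ * ‖c' y‖⁻¹) • c' y := by
    filter_upwards [hcc', hne, orientationSign_mul_det_eventually o x₀] with y hy hy' hsgn
    set d : ℝ := LinearMap.det ((T y : 𝔼 n →L[ℝ] 𝔼 n) : 𝔼 n →ₗ[ℝ] 𝔼 n) with hd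
    have hsd : orientationSignStd o y * d = orientationSignStd o x₀ * |d| := hsgn d rfl hy'.1
    have habs : |d| ≠ 0 := abs_ne_zero.2 hy'.1
    rw [orientedNormal, hy, norm_smul, Real.norm_eq_abs, smul_smul]
    congr 1
    calc orientationSignStd o y * (|d| * ‖c' y‖)⁻¹ * d
        = (orientationSignStd o y * d) * |d|⁻¹ * ‖c' y‖⁻¹ := by rw [mul_inv]; ring
      _ = orientationSignStd o x₀ * |d| * |d|⁻¹ * ‖c' y‖⁻¹ := by rw [hsd]
      _ = orientationSignStd o x₀ * ‖c' y‖⁻¹ := by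
          rw [mul_assoc (orientationSignStd o x₀) |d|, mul_inv_cancel₀ habs, mul_one]
  -- conclude
  have hcont : ContinuousAt (fun y => (orientationSignStd o x₀ * ‖c' y‖⁻¹) • c' y) x₀ := by
    have h1 : ContinuousAt (fun y => orientationSignStd o x₀ * ‖c' y‖⁻¹) x₀ :=
      continuousAt_const.mul (hc'c.norm.inv₀ (norm_ne_zero_iff.2 hc'0))
    exact h1.smul hc'c
  exact hcont.congr (EventuallyEq.symm hloc)

end Normal

/-! ### §3 The stable framing -/

section Framing

variable {n : ℕ} {M : Type*} [TopologicalSpace M] [ChartedSpace (𝔼 n) M] [IsManifold (𝓡 n) 1 M]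

/-- The set of invertible continuous linear maps `ℝⁿ × ℝ →L ℝⁿ⁺¹` is open (Mathlib's
`ContinuousLinearEquiv.isOpen`). [folklore] -/
theorem isOpen_setOf_isInvertible_prod :
    IsOpen {f : (𝔼 n × ℝ) →L[ℝ] 𝔼 (n+1) | f.IsInvertible} := by
  convert ContinuousLinearEquiv.isOpen (𝕜 := ℝ) (E := 𝔼 n × ℝ) (F := 𝔼 (n+1)) using 1
  ext f
  simp only [mem_setOf_eq, ContinuousLinearMap.IsInvertible, mem_range]

/-- **An oriented `n`-manifold with a `C¹` immersion into `ℝⁿ⁺¹` is stably parallelizable**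
(Kervaire–Milnor 1963, §3 p. 508; Milnor–Stasheff §2; Hirsch Ch. 4 §4): the maps
`Φ_x (u, r) = dF_x u + r • ξ x`, `ξ` the oriented unit normal, are linear isomorphisms
`T_x M ⊕ ℝ ≅ ℝⁿ⁺¹` depending continuously on `x`, so `x ↦ Φ_x⁻¹ eⱼ` is a framing of `TM ⊕ ℝ`.
[cite: KervaireMilnorAnnals1963, §3 p. 508] [cite: MilnorStasheff1974, §2] [cite: HirschDT1976, Ch. 4 §4] -/
theorem isStablyParallelizable_of_immersion_succ (o : SmoothOrientation (𝓡 n) M) {F : M → 𝔼 (n+1)}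
    (hF : ContMDiff (𝓡 n) (𝓡 (n+1)) 1 F) (hinj : ∀ x, Injective (mfderiv (𝓡 n) (𝓡 (n+1)) F x)) :
    IsStablyParallelizable (𝓡 n) M := by
  classical
  have hinj' : ∀ x, Injective (mfderivE F x) := hinj
  set ξ : M → 𝔼 (n+1) := orientedNormal o F with hξ
  have hξc : Continuous ξ := continuous_orientedNormal o hF hinj'
  -- the splitting maps `Φ_x (u, r) = dF_x u + r • ξ x`
  set Φ : M → (𝔼 n × ℝ) →L[ℝ] 𝔼 (n+1) := fun x =>
    (mfderivE F x).comp (ContinuousLinearMap.fst ℝ (𝔼 n) ℝ) +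
      ContinuousLinearMap.smulRightL ℝ (𝔼 n × ℝ) (𝔼 (n+1)) (ContinuousLinearMap.snd ℝ (𝔼 n) ℝ)
        (ξ x) with hΦdef
  have hΦapply : ∀ x (u : 𝔼 n) (r : ℝ), Φ x (u, r) = mfderivE F x u + r • ξ x := by
    intro x u r
    rfl
  -- `Φ_x` is injective, hence invertible (dimensions agree)
  have hΦinj : ∀ x, Injective (Φ x) := by
    intro x q q' h
    obtain ⟨u, r⟩ := q
    obtain ⟨u', r'⟩ := q'
    have h0 : Φ x (u - u', r - r') = 0 := by
      have : ((u - u', r - r') : 𝔼 n × ℝ) = (u, r) - (u', r') := rfl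
      rw [this, map_sub, h, sub_self]
    rw [hΦapply] at h0
    obtain ⟨hu, hr⟩ := eq_zero_of_mfderiv_add_smul_orientedNormal o (hinj' x) h0
    rw [sub_eq_zero] at hu hr
    rw [hu, hr]
  have hdim : finrank ℝ (𝔼 n) + 1 = n + 1 := by rw [finrank_euclideanSpace_fin]
  have hΦinv : ∀ x, (Φ x).IsInvertible := by
    intro x
    have hfr : finrank ℝ (𝔼 n × ℝ) = finrank ℝ (𝔼 (n+1)) := by
      rw [finrank_prod, finrank_self, finrank_euclideanSpace_fin, finrank_euclideanSpace_fin]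
    have hsurj : Surjective (Φ x) :=
      (LinearMap.injective_iff_surjective_of_finrank_eq_finrank hfr).1 (hΦinj x)
    let e : (𝔼 n × ℝ) ≃L[ℝ] 𝔼 (n+1) :=
      (LinearEquiv.ofBijective (Φ x).toLinearMap ⟨hΦinj x, hsurj⟩).toContinuousLinearEquiv
    exact ⟨e, ContinuousLinearMap.ext fun q => rfl⟩
  -- the target frame
  set b : Fin (finrank ℝ (𝔼 n) + 1) → 𝔼 (n+1) := fun j =>
    EuclideanSpace.single (Fin.cast hdim j) (1 : ℝ) with hb
  have hbli : LinearIndependent ℝ b :=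
    (linearIndependent_euclideanSingle_one (n+1)).comp (Fin.cast hdim) (Fin.cast_injective hdim)
  -- continuity of the frame `x ↦ Φ_x⁻¹ (b j)` in the trivialisation at each `x₀`
  have key : ∀ (j : Fin (finrank ℝ (𝔼 n) + 1)) (x₀ : M), ContinuousAt (fun x =>
      ((trivializationAt (𝔼 n) (TangentSpace (𝓡 n)) x₀
          (⟨x, ((Φ x).inverse (b j)).1⟩ : TangentBundle (𝓡 n) M)).2, ((Φ x).inverse (b j)).2)) x₀ := by
    intro j x₀
    set A : M → 𝔼 n →L[ℝ] 𝔼 (n+1) :=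
      inTangentCoordinates (𝓡 n) (𝓡 (n+1)) id F (mfderiv (𝓡 n) (𝓡 (n+1)) F) x₀ with hA
    have hAc : ContinuousAt A x₀ :=
      ((hF x₀).mfderiv_const (m := 0) (by rw [zero_add])).continuousAt
    -- `Φ` in coordinates
    set Ψ : M → (𝔼 n × ℝ) →L[ℝ] 𝔼 (n+1) := fun x =>
      (A x).comp (ContinuousLinearMap.fst ℝ (𝔼 n) ℝ) +
        ContinuousLinearMap.smulRightL ℝ (𝔼 n × ℝ) (𝔼 (n+1)) (ContinuousLinearMap.snd ℝ (𝔼 n) ℝ)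
          (ξ x) with hΨdef
    have hΨapply : ∀ x (u : 𝔼 n) (r : ℝ), Ψ x (u, r) = A x u + r • ξ x := by
      intro x u r
      rfl
    have hΨc : ContinuousAt Ψ x₀ := by
      refine (hAc.clm_comp continuousAt_const).add ?_
      exact (ContinuousLinearMap.smulRightL ℝ (𝔼 n × ℝ) (𝔼 (n+1))
        (ContinuousLinearMap.snd ℝ (𝔼 n) ℝ)).continuous.continuousAt.comp hξc.continuousAt
    -- at `x₀` the coordinate change is the identity: `Ψ x₀ = Φ x₀`
    have hA0 : A x₀ = mfderivE F x₀ := by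
      rw [hA, inTangentCoordinates_eq _ _ _ (mem_chart_source (𝔼 n) x₀) (by simp)]
      refine ContinuousLinearMap.ext fun v => ?_
      change (tangentBundleCore (𝓡 (n+1)) (𝔼 (n+1))).coordChange (achart (𝔼 (n+1)) (F x₀))
        (achart (𝔼 (n+1)) (F x₀)) (F x₀) (mfderivE F x₀
          (tangentCoordChange (𝓡 n) x₀ x₀ x₀ v)) = _
      rw [tangentBundleCore_coordChange_model_space, tangentCoordChange_self (by simp)]
      rfl
    have hΨ0 : Ψ x₀ = Φ x₀ := by
      refine ContinuousLinearMap.ext fun q => ?_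
      obtain ⟨u, r⟩ := q
      rw [hΨapply, hΦapply, hA0]
    have hΨinv : ∀ᶠ x in 𝓝 x₀, (Ψ x).IsInvertible :=
      hΨc.preimage_mem_nhds (isOpen_setOf_isInvertible_prod.mem_nhds
        (by rw [mem_setOf_eq, hΨ0]; exact hΦinv x₀))
    have h1 : ∀ᶠ x in 𝓝 x₀, x ∈ (chartAt (𝔼 n) x₀).source :=
      (chartAt (𝔼 n) x₀).open_source.mem_nhds (mem_chart_source (𝔼 n) x₀)
    -- near `x₀`, `Ψ x` maps the frame read at `x₀` to `b j`
    have hid : ∀ᶠ x in 𝓝 x₀, Ψ x ((trivializationAt (𝔼 n) (TangentSpace (𝓡 n)) x₀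
        (⟨x, ((Φ x).inverse (b j)).1⟩ : TangentBundle (𝓡 n) M)).2, ((Φ x).inverse (b j)).2) =
          b j := by
      filter_upwards [h1] with x hx
      have hx' : x ∈ (extChartAt (𝓡 n) x).source ∩ (extChartAt (𝓡 n) x₀).source ∩
          (extChartAt (𝓡 n) x).source := by
        simp only [extChartAt_source, mem_inter_iff, mem_chart_source, hx, and_self]
      have hAp : ∀ v : 𝔼 n, A x (tangentCoordChange (𝓡 n) x x₀ x v) = mfderivE F x v := by
        intro v
        rw [hA, inTangentCoordinates_eq _ _ _ (show id x ∈ (chartAt (𝔼 n) (id x₀)).source from hx)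
          (by simp)]
        change (tangentBundleCore (𝓡 (n+1)) (𝔼 (n+1))).coordChange (achart (𝔼 (n+1)) (F x))
          (achart (𝔼 (n+1)) (F x₀)) (F x) (mfderivE F x
            (tangentCoordChange (𝓡 n) x₀ x x (tangentCoordChange (𝓡 n) x x₀ x v))) = _
        rw [tangentBundleCore_coordChange_model_space, tangentCoordChange_comp hx',
          tangentCoordChange_self (by simp)]
        rfl
      have h5 : mfderivE F x ((Φ x).inverse (b j)).1 +
          ((Φ x).inverse (b j)).2 • ξ x = b j := by
        have h6 := hΦapply x ((Φ x).inverse (b j)).1 ((Φ x).inverse (b j)).2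
        rw [Prod.mk.eta, (hΦinv x).self_apply_inverse] at h6
        exact h6.symm
      have htriv : (trivializationAt (𝔼 n) (TangentSpace (𝓡 n)) x₀
          (⟨x, ((Φ x).inverse (b j)).1⟩ : TangentBundle (𝓡 n) M)).2 =
            tangentCoordChange (𝓡 n) x x₀ x ((Φ x).inverse (b j)).1 := rfl
      rw [htriv, hΨapply, hAp]
      exact h5
    -- conclude: near `x₀` the frame reads `(Ψ x)⁻¹ (b j)`
    obtain ⟨e, he⟩ := (show (Ψ x₀).IsInvertible by rw [hΨ0]; exact hΦinv x₀)
    have hinvc : ContinuousAt (fun x => (Ψ x).inverse (b j)) x₀ := by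
      have h1 : ContinuousAt ContinuousLinearMap.inverse (Ψ x₀) := by
        rw [← he]
        exact (contDiffAt_map_inverse (n := 0) e).continuousAt
      exact (h1.comp hΨc).clm_apply continuousAt_const
    refine hinvc.congr ?_
    filter_upwards [hid, hΨinv] with x hx hxinv
    conv_lhs => rw [← hx]
    rw [hxinv.inverse_apply_self]
  refine ⟨fun j x => (Φ x).inverse (b j), fun j => ?_, fun j => ?_, fun x => ?_⟩
  · -- continuity of the tangent components, checked in the trivialisation at each `x₀`
    rw [continuous_iff_continuousAt]
    intro x₀
    rw [show (fun x : M => (TotalSpace.mk' (𝔼 n) (id x) ((Φ x).inverse (b j)).1 :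
        TangentBundle (𝓡 n) M)) = fun x : M => TotalSpace.mk' (𝔼 n) x
          ((fun q : M => (((Φ q).inverse (b j)).1 : TangentSpace (𝓡 n) q)) x) from rfl,
      FiberBundle.continuousAt_section]
    exact (key j x₀).fst
  · -- continuity of the real components
    rw [continuous_iff_continuousAt]
    intro x₀
    exact (key j x₀).snd
  · -- pointwise linear independence: `Φ_x` maps the family to the frame `b`
    have hli : LinearIndependent ℝ fun j => (Φ x).inverse (b j) := by
      refine LinearIndependent.of_comp (Φ x).toLinearMap ?_
      convert hbli using 1
      funext j
      exact (hΦinv x).self_apply_inverse (b j)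
    exact hli

end Framing

end Literature.Topology.FourManifolds

end
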